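import Summits.AtomisticToContinuum.BoseEinsteinCondensation.Theorems.BECSubharmonicContinuationHarmonicMinorantBallMean

/-!
# Route BECSubharmonicContinuation · support `HarmonicMinorant` (stmt-AtomisticToContinuum-9003), V:
# the volumetric Gauss mean-value identity on `ℝ³`

Helper file (pure analysis on `ℝ³`). Letting `ε → 0⁺` in
`∫ Δu·(N_ε - N_S) = (3/4π)(S⁻³∫_{B_S} u - ε⁻³∫_{B_ε} u)`:

* `tendsto_ballMean` — `(3/4π) ε⁻³ ∫_{B_ε} u → u(0)` for continuous `u` (rescale to the unit ball,
  dominated convergence);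
* `tendsto_integral_laplacian_mul_testKernel` — `∫ Δu·(N_ε - N_S) → ∫_{B_S} Δu·K_S`,
  `K_S(y) = 1/(4π|y|) - (3S² - |y|²)/(8πS³)` (dominated convergence; `N_ε(y) = 1/(4π|y|)` once
  `ε ≤ |y|`, domination by `C(1/(4π|y|) + 3/(8πS))1_{B_S}`, `1/|y| ∈ L¹(B_S)`);
* `ballMean_sub_center_eq`, `center_sub_ballAverage_eq` — **the volumetric Gauss mean-value
  identity** `u(0) - ⨍_{B_S} u = ∫_{B_S} (-Δu)(y) K_S(y) dy` for `u ∈ C²(ℝ³)`, `S > 0`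
  (Green's representation formula in `B_S` with the radially averaged Green function of the ball;
  Gilbarg–Trudinger Thm 2.1 / (2.16)–(2.17), here boundary-free).

Notation in the docstrings: `ℝ³ = Space = EuclideanSpace ℝ (Fin 3)`; `N_a(y) = (3m² - |y|²)/(8πm³)`
with `m = max a |y|` is the potential of the uniform unit charge on `B_a` (written out explicitly in
the statements, no definitions), `n_a(q)` the same profile in the variable `q = |y|²`
(`m = max a √q`), and `K_S(y) = 1/(4π|y|) - (3S² - |y|²)/(8πS³)` the ball kernel.

## References

* D. Gilbarg, N. S. Trudinger, *Elliptic Partial Differential Equations of Second Order*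
  (Springer 2001), Thm 2.1 (mean value), (2.10)–(2.17) (Green's identities and representation)
  [GilbargTrudinger2001].
* E. H. Lieb, R. Seiringer, J. P. Solovej, J. Yngvason, *The Mathematics of the Bose Gas and its
  Condensation* (2005), §1.2 (1.17)–(1.19) (one-body density matrix) [LiebSeiringerSolovejYngvason2005].
-/

noncomputable section

open MeasureTheory Filter Metric Set Function Real InnerProductSpace
open scoped ComplexConjugate Topology RealInnerProductSpace Laplacian

namespace Summit.AtomisticToContinuum.BoseEinsteinCondensation.Theorems

namespace HarmonicMinorant

open Literature.MathematicalPhysics.QuantumManyBody.BoseGas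

/-! ### The limit `ε → 0` -/

/-- **Ball means of a continuous function converge to its value at the centre**:
`(3/4π) ε⁻³ ∫_{B_ε} u → u(0)` as `ε → 0⁺`. [folklore] -/
theorem tendsto_ballMean {u : Space → ℝ} (hu : Continuous u) :
    Tendsto (fun ε : ℝ => 3 / (4 * Real.pi) * ((ε ^ 3)⁻¹ * ∫ y in ball (0 : Space) ε, u y))
      (𝓝[>] 0) (𝓝 (u 0)) := by
  -- the rescaled family `J ε = ∫_{B₁} u(εz) dz`, continuous at `ε = 0`
  set J : ℝ → ℝ := fun ε => ∫ z in ball (0 : Space) 1, u (ε • z) with hJ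
  obtain ⟨C, hC⟩ := (isCompact_closedBall (0 : Space) 1).exists_bound_of_continuousOn hu.continuousOn
  have hJc : ContinuousAt J 0 := by
    refine continuousAt_of_dominated (bound := fun _ => C) ?_ ?_ ?_ ?_
    · exact Eventually.of_forall fun ε =>
        (hu.comp (continuous_id.const_smul ε)).aestronglyMeasurable
    · filter_upwards [ball_mem_nhds (0 : ℝ) one_pos] with ε hε
      filter_upwards [ae_restrict_mem measurableSet_ball] with z hz
      refine hC _ (mem_closedBall_zero_iff.2 ?_)
      rw [norm_smul]
      rw [mem_ball_zero_iff] at hε hz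
      nlinarith [norm_nonneg ε, norm_nonneg z]
    · exact integrableOn_const (measure_ball_lt_top.ne)
    · exact Eventually.of_forall fun z =>
        (hu.comp (continuous_id.smul continuous_const)).continuousAt
  have hvol : (volume : Measure Space).real (ball (0 : Space) 1) = 4 * Real.pi / 3 := by
    rw [Measure.real, EuclideanSpace.volume_ball_fin_three, ENNReal.toReal_mul, ENNReal.toReal_pow,
      ENNReal.toReal_ofReal zero_le_one, ENNReal.toReal_ofReal (by positivity)]
    ring
  have hJ0 : J 0 = 4 * Real.pi / 3 * u 0 := by
    simp only [hJ, zero_smul]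
    rw [setIntegral_const, hvol, smul_eq_mul]
  -- `(3/4π) J ε → u 0`
  have h1 : Tendsto (fun ε => 3 / (4 * Real.pi) * J ε) (𝓝[>] 0) (𝓝 (u 0)) := by
    have h : Tendsto (fun ε => 3 / (4 * Real.pi) * J ε) (𝓝[>] 0)
        (𝓝 (3 / (4 * Real.pi) * J 0)) :=
      (hJc.tendsto.const_mul (3 / (4 * Real.pi))).mono_left (nhdsWithin_le_nhds (s := Ioi 0))
    rw [hJ0] at h
    convert h using 2
    field_simp
  refine h1.congr' ?_
  filter_upwards [self_mem_nhdsWithin] with ε hε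
  simp only [hJ]
  rw [setIntegral_unitBall_comp_smul u (mem_Ioi.1 hε), smul_eq_mul]

/-- The limiting kernel `K_S(y) = 1/(4π|y|) - (3S² - |y|²)/(8πS³)` on `B_S` is the pointwise limit of
the regularised kernels off the origin: for `0 < ε ≤ |y|`,
`N_ε(y) - N_S(y) = 1_{B_S}(y) K_S(y)`. [folklore] -/
theorem testKernel_eq_indicator {ε S : ℝ} (hε : 0 < ε) (hS : 0 < S) {y : Space} (hy : ε ≤ ‖y‖) :
    ((3 * (max ε ‖y‖) ^ 2 - ‖y‖ ^ 2) / (8 * Real.pi * (max ε ‖y‖) ^ 3)) -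
        ((3 * (max S ‖y‖) ^ 2 - ‖y‖ ^ 2) / (8 * Real.pi * (max S ‖y‖) ^ 3)) = (ball (0 : Space) S).indicator
      (fun y => (4 * Real.pi * ‖y‖)⁻¹ - (3 * S ^ 2 - ‖y‖ ^ 2) / (8 * Real.pi * S ^ 3)) y := by
  rw [ubp_of_le_norm hε hy]
  by_cases hyS : y ∈ ball (0 : Space) S
  · rw [indicator_of_mem hyS, ubp_of_norm_le (le_of_lt (mem_ball_zero_iff.1 hyS))]
  · rw [indicator_of_notMem hyS, ubp_of_le_norm hS (not_lt.1 (mt mem_ball_zero_iff.2 hyS)),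
      sub_self]

/-- Uniform bound on the regularised kernels off the origin: `|N_ε - N_S| ≤ 1/(4π|y|) + 3/(8πS)`
on `B_S`, `0` outside. [folklore] -/
theorem abs_testKernel_le {ε S : ℝ} (hε : 0 < ε) (hεS : ε ≤ S) {y : Space} (hy : y ≠ 0) :
    |((3 * (max ε ‖y‖) ^ 2 - ‖y‖ ^ 2) / (8 * Real.pi * (max ε ‖y‖) ^ 3)) -
        ((3 * (max S ‖y‖) ^ 2 - ‖y‖ ^ 2) / (8 * Real.pi * (max S ‖y‖) ^ 3))| ≤ (ball (0 : Space) S).indicator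
      (fun y => (4 * Real.pi * ‖y‖)⁻¹ + 3 / (8 * Real.pi * S)) y := by
  have hS : 0 < S := hε.trans_le hεS
  by_cases hyS : y ∈ ball (0 : Space) S
  · rw [indicator_of_mem hyS, abs_le]
    constructor
    · have h1 := ubp_nonneg hε y
      have h2 := ubp_le_center hS y
      have h3 : 0 ≤ (4 * Real.pi * ‖y‖)⁻¹ := by positivity
      linarith
    · have h1 := ubp_le_newton hε hy
      have h2 := ubp_nonneg hS y
      have h3 : 0 ≤ 3 / (8 * Real.pi * S) := by positivity
      linarith
  · rw [indicator_of_notMem hyS, testKernel_eq_zero hε hεS (not_lt.1 (mt mem_ball_zero_iff.2 hyS)),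
      abs_zero]

/-- The dominating function is integrable (`1/|y|` is integrable on balls of `Space`). [folklore] -/
theorem integrable_dominator (C S : ℝ) :
    Integrable (fun y : Space => (ball (0 : Space) S).indicator
      (fun y => C * ((4 * Real.pi * ‖y‖)⁻¹ + 3 / (8 * Real.pi * S))) y) := by
  rw [integrable_indicator_iff measurableSet_ball]
  have h1 : IntegrableOn (fun y : Space => C * (4 * Real.pi * ‖y‖)⁻¹) (ball (0 : Space) S) volume := by
    refine integrableOn_ball_of_norm_le_rpow (by rw [finrank_euclideanSpace_fin]; norm_num)
      (C := |C| * (4 * Real.pi)⁻¹) (α := 1) (by rw [finrank_euclideanSpace_fin]; norm_num)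
      (Eventually.of_forall fun y => ?_) ?_
    · rw [Real.rpow_neg_one, norm_mul, Real.norm_eq_abs, Real.norm_eq_abs, abs_inv,
        abs_of_nonneg (by positivity : (0 : ℝ) ≤ 4 * Real.pi * ‖y‖), mul_inv, mul_assoc]
    · exact (measurable_const.mul ((measurable_const.mul continuous_norm.measurable).inv)
        |>.aestronglyMeasurable)
  have h2 : IntegrableOn (fun _ : Space => C * (3 / (8 * Real.pi * S))) (ball (0 : Space) S) volume :=
    integrableOn_const (measure_ball_lt_top.ne)
  have h := h1.add h2
  refine h.congr_fun (fun y _ => ?_) measurableSet_ball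
  simp only [Pi.add_apply]
  ring

/-- **Dominated convergence as `ε → 0⁺`**:
`∫ Δu · (N_ε - N_S) → ∫_{B_S} Δu · K_S`, `K_S(y) = 1/(4π|y|) - (3S² - |y|²)/(8πS³)`. [folklore] -/
theorem tendsto_integral_laplacian_mul_testKernel {S : ℝ} (hS : 0 < S) {u : Space → ℝ}
    (hu : ContDiff ℝ 2 u) :
    Tendsto (fun ε : ℝ => ∫ y, (Δ u) y * (((3 * (max ε ‖y‖) ^ 2 - ‖y‖ ^ 2) / (8 * Real.pi * (max ε ‖y‖) ^ 3)) -
        ((3 * (max S ‖y‖) ^ 2 - ‖y‖ ^ 2) / (8 * Real.pi * (max S ‖y‖) ^ 3)))) (𝓝[>] 0)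
      (𝓝 (∫ y, (Δ u) y * (ball (0 : Space) S).indicator
        (fun y => (4 * Real.pi * ‖y‖)⁻¹ - (3 * S ^ 2 - ‖y‖ ^ 2) / (8 * Real.pi * S ^ 3)) y)) := by
  have hΔ : Continuous (Δ u) := Literature.Analysis.FluidPDE.continuous_laplacian hu
  obtain ⟨C, hC⟩ := (isCompact_closedBall (0 : Space) S).exists_bound_of_continuousOn hΔ.continuousOn
  have hC0 : 0 ≤ C := (norm_nonneg _).trans (hC 0 (mem_closedBall_self hS.le))
  have hae : ∀ᵐ y ∂(volume : Measure Space), y ≠ (0 : Space) := by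
    rw [ae_iff]
    simp
  refine tendsto_integral_filter_of_dominated_convergence
    (fun y => (ball (0 : Space) S).indicator
      (fun y => C * ((4 * Real.pi * ‖y‖)⁻¹ + 3 / (8 * Real.pi * S))) y) ?_ ?_
    (integrable_dominator C S) ?_
  · filter_upwards [self_mem_nhdsWithin] with ε hε
    exact (hΔ.mul (contDiff_testKernel (mem_Ioi.1 hε) hS).continuous).aestronglyMeasurable
  · filter_upwards [Ioo_mem_nhdsGT hS] with ε hε
    filter_upwards [hae] with y hy
    rw [norm_mul, Real.norm_eq_abs, Real.norm_eq_abs]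
    have h1 := abs_testKernel_le hε.1 hε.2.le hy (S := S)
    by_cases hyS : y ∈ ball (0 : Space) S
    · rw [indicator_of_mem hyS] at h1 ⊢
      exact mul_le_mul (hC y (ball_subset_closedBall hyS)) h1 (abs_nonneg _) hC0
    · rw [indicator_of_notMem hyS] at h1 ⊢
      have : |((3 * (max ε ‖y‖) ^ 2 - ‖y‖ ^ 2) / (8 * Real.pi * (max ε ‖y‖) ^ 3)) -
          ((3 * (max S ‖y‖) ^ 2 - ‖y‖ ^ 2) / (8 * Real.pi * (max S ‖y‖) ^ 3))| = 0 := le_antisymm h1 (abs_nonneg _)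
      rw [this, mul_zero]
  · filter_upwards [hae] with y hy
    have hev : ∀ᶠ ε : ℝ in 𝓝[>] 0, (Δ u) y * (ball (0 : Space) S).indicator
        (fun y => (4 * Real.pi * ‖y‖)⁻¹ - (3 * S ^ 2 - ‖y‖ ^ 2) / (8 * Real.pi * S ^ 3)) y =
        (Δ u) y * (((3 * (max ε ‖y‖) ^ 2 - ‖y‖ ^ 2) / (8 * Real.pi * (max ε ‖y‖) ^ 3)) -
            ((3 * (max S ‖y‖) ^ 2 - ‖y‖ ^ 2) / (8 * Real.pi * (max S ‖y‖) ^ 3))) := by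
      filter_upwards [Ioo_mem_nhdsGT (norm_pos_iff.2 hy)] with ε hε
      rw [testKernel_eq_indicator hε.1 hS hε.2.le]
    exact tendsto_const_nhds.congr' hev

/-- **The volumetric Gauss mean-value identity on `Space`** (ball mean with Newtonian remainder):
for `u ∈ C²(Space)` and `S > 0`,
`(3/4πS³) ∫_{B_S} u - u(0) = ∫_{B_S} Δu(y) (1/(4π|y|) - (3S² - |y|²)/(8πS³)) dy`
— Green's representation formula in the ball `B_S` with the Green function of the ball averaged over
the radius (the kernel is `Γ - Γ * 1_{B_S}/|B_S|`, vanishing to first order on `∂B_S`), proved here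
boundary-free by regularisation and dilation. [cite: GilbargTrudinger2001, Thm 2.1 and (2.16)–(2.17)] -/
theorem ballMean_sub_center_eq {S : ℝ} (hS : 0 < S) {u : Space → ℝ} (hu : ContDiff ℝ 2 u) :
    3 / (4 * Real.pi) * ((S ^ 3)⁻¹ * ∫ y in ball (0 : Space) S, u y) - u 0 =
      ∫ y in ball (0 : Space) S, (Δ u) y *
        ((4 * Real.pi * ‖y‖)⁻¹ - (3 * S ^ 2 - ‖y‖ ^ 2) / (8 * Real.pi * S ^ 3)) := by
  have hlim1 := tendsto_integral_laplacian_mul_testKernel hS hu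
  have hlim2 : Tendsto (fun ε : ℝ => 3 / (4 * Real.pi) * ((S ^ 3)⁻¹ * (∫ y in ball (0 : Space) S, u y) -
      (ε ^ 3)⁻¹ * (∫ y in ball (0 : Space) ε, u y))) (𝓝[>] 0)
      (𝓝 (3 / (4 * Real.pi) * ((S ^ 3)⁻¹ * ∫ y in ball (0 : Space) S, u y) - u 0)) := by
    have h := (tendsto_const_nhds (x := 3 / (4 * Real.pi) * ((S ^ 3)⁻¹ *
      ∫ y in ball (0 : Space) S, u y))).sub (tendsto_ballMean hu.continuous)
    refine h.congr' (Eventually.of_forall fun ε => ?_)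
    ring
  have heq : (fun ε : ℝ => 3 / (4 * Real.pi) * ((S ^ 3)⁻¹ * (∫ y in ball (0 : Space) S, u y) -
      (ε ^ 3)⁻¹ * (∫ y in ball (0 : Space) ε, u y))) =ᶠ[𝓝[>] 0]
      fun ε : ℝ => ∫ y, (Δ u) y * (((3 * (max ε ‖y‖) ^ 2 - ‖y‖ ^ 2) / (8 * Real.pi * (max ε ‖y‖) ^ 3)) -
          ((3 * (max S ‖y‖) ^ 2 - ‖y‖ ^ 2) / (8 * Real.pi * (max S ‖y‖) ^ 3))) := by
    filter_upwards [Ioo_mem_nhdsGT hS] with ε hε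
    rw [integral_laplacian_mul_testKernel_eq hε.1 hε.2.le hu]
  have h := tendsto_nhds_unique (hlim2.congr' heq) hlim1
  rw [h]
  rw [← integral_indicator measurableSet_ball]
  refine integral_congr_ae (Eventually.of_forall fun y => ?_)
  simp only [indicator]
  split_ifs <;> simp

/-- `|B_S| = 4πS³/3`. [folklore] -/
theorem volume_real_ball {S : ℝ} (hS : 0 ≤ S) :
    (volume : Measure Space).real (ball (0 : Space) S) = 4 * Real.pi / 3 * S ^ 3 := by
  rw [Measure.real, EuclideanSpace.volume_ball_fin_three, ENNReal.toReal_mul, ENNReal.toReal_pow,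
    ENNReal.toReal_ofReal hS, ENNReal.toReal_ofReal (by positivity)]
  ring

/-- **The volumetric Gauss mean-value identity**, average form: for `u ∈ C²(Space)` and `S > 0`,
`u(0) - ⨍_{B_S} u = ∫_{B_S} (-Δu)(y) (1/(4π|y|) - (3S² - |y|²)/(8πS³)) dy`.
[cite: GilbargTrudinger2001, Thm 2.1 and (2.16)–(2.17)] -/
theorem center_sub_ballAverage_eq {S : ℝ} (hS : 0 < S) {u : Space → ℝ} (hu : ContDiff ℝ 2 u) :
    u 0 - ⨍ y in ball (0 : Space) S, u y =
      ∫ y in ball (0 : Space) S, (-(Δ u) y) *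
        ((4 * Real.pi * ‖y‖)⁻¹ - (3 * S ^ 2 - ‖y‖ ^ 2) / (8 * Real.pi * S ^ 3)) := by
  have h := ballMean_sub_center_eq hS hu
  rw [setAverage_eq, volume_real_ball hS.le, smul_eq_mul]
  have hpi : Real.pi ≠ 0 := Real.pi_ne_zero
  have hS3 : S ^ 3 ≠ 0 := pow_ne_zero 3 hS.ne'
  have e : (4 * Real.pi / 3 * S ^ 3)⁻¹ = 3 / (4 * Real.pi) * (S ^ 3)⁻¹ := by
    field_simp
  rw [e, mul_assoc, ← neg_sub, h, ← integral_neg]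
  refine integral_congr_ae (Eventually.of_forall fun y => ?_)
  ring

end HarmonicMinorant

end Summit.AtomisticToContinuum.BoseEinsteinCondensation.Theorems
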